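import Mathlib
import Summits.ValiantsHypothesis.ValiantsHypothesis.Theorems.LacunarySymmetroidMatrixDescartesCensusDefs
import Summits.ValiantsHypothesis.ValiantsHypothesis.Theorems.LacunarySymmetroidMatrixDescartesStubDescartesCeiling

/-!
# Tower graft line — THE PAIR LAW: two exact kernel directions share ONE size-1 budget («sharp pencils must rotate»)

Mechanism/calibration file for the line `Cruxes/WeakLifting/Lines/tower_graft.lean` (crux `WeakLifting` = stmt-ValiantsHypothesis-19561,
restricted sub-case `TowerWeakLifting`; T5 side, handle (h4) «rotation»).  NO stub is claimed.  Companion of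
`…TowerGraftKernelConfinement.lean` (p665004: exact kernel confinement ⇒ `Z₊(det G) ≤ |fam| · B`), which this file SHARPENS BY A FACTOR TWO at
`ι = ∅` and turns into a quantified rotation floor (memo `ROTATION-CALIBRATION-liftp3g18.md`, evidence on 19561; planner val-idea-24 g0 GO
2026-08-28T20:33:54Z).

For a symmetric `N`-pencil `G = ∑ₗ X^{dₗ} • Sₗ` on the support `d` and CONSTANT real vectors `x, y`, the bilinear compression
`g_{x,y} := x̂ ⬝ᵥ G *ᵥ ŷ = ∑ₗ (xᵀ Sₗ y) X^{dₗ}` is the determinant of a `1 × 1` pencil on the SAME support (§1, `dotProduct_pencil_mulVec_eq_det`),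
so it obeys the size-1 law (`card_posRoots_dotProduct_pencil_mulVec_le`: `Z₊(g_{x,y}) ≤ B` under `PosRootLawOn 1 K B d`; Descartes gives
`B = K − 1`, `posRootLawOn_one_descartes`).  THE PAIR LAW (§2): `G(t) x = 0` kills `g_{x,y}(t)` AND `g_{y,x}(t)` for every `y`
(`eval_dotProduct_pencil_mulVec_eq_zero_of_kernel_left/right`, symmetry), hence the positive roots of `det G` at which `x` OR `y` is a kernel
vector all lie among the positive roots of the single `K`-nomial `g_{x,y}`:
`card_posRoots_union_le_of_kernel_pair : |T_x ∪ T_y| ≤ Z₊(g_{x,y}) (≤ B(1; d) ≤ K − 1)` unless `g_{x,y} ≡ 0` (the letter-orthogonal escape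
`xᵀSₗy = 0 ∀ l`, the diagonal / zero-rotation corner).  COUNTING COROLLARY (§3, double counting over ordered pairs): if `R ≥ 2` constant vectors
`x_a` (`a ∈ fam`) capture every positive root of `det G` as an exact kernel vector and no two are letter-orthogonal, then
`two_mul_card_posRoots_le : 2 · Z₊(det G) ≤ R · B` — half the bound `R · B(1; d)` of p665004; with Descartes, a pencil with `Z₊` positive roots
needs `R ≥ 2 Z₊ / (K − 1)` exact kernel directions, e.g. a Descartes-sharp `(2, K)` pencil (`Z₊ = C(K+1,2) − 1`) needs `R ≥ K + 2`, and at
`(2,3)` all five roots have pairwise distinct kernel directions.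

Def-free; Mathlib + the cell's `…CensusDefs` / `…StubDescartesCeiling` (`PosRootLawOn`, `stub_descartesCeiling`).  HONEST FRAMING: an exact
structural constraint on pencils with REPEATED kernel directions; generic pencils repeat none (memo §1), so this calibrates the rotation
charge rather than bounding any count; T5, S4f, TowerB, `WeakLifting`, Conjecture B / `KPlusLogSqLaw`, `MatrixDescartes` (18050) and `VP ≠ VNP`
are untouched.  Seat: prover val-sym-lift-p3 g18, `--supports stmt-ValiantsHypothesis-19561`.
-/

-- `Summit.ValiantsHypothesis.ValiantsHypothesis.…` repeats a component by the D-0017 layout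
-- (single-conjunct summit), which the `dupNamespace` linter flags; the name is mandated.
set_option linter.dupNamespace false

namespace Summit.ValiantsHypothesis.ValiantsHypothesis.Theorems.KPlusLogSqLaw.TowerGraft

open Finset Polynomial Matrix
open scoped BigOperators Polynomial
open Summit.ValiantsHypothesis.ValiantsHypothesis.Theorems.LacunarySymmetroidMatrixDescartes (PosRootLawOn)

variable {n : Type*} [Fintype n] {K : ℕ}

/-! ## §1 The bilinear compression `x̂ ⬝ᵥ G *ᵥ ŷ` is a `1 × 1` pencil on the same support -/

/-- the bilinear compression of a lacunary pencil along constant vectors, letterwise: `x̂ ⬝ᵥ (∑ X^{dₗ} • Sₗ) *ᵥ ŷ = ∑ (xᵀSₗy) X^{dₗ}`.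
[folklore] -/
theorem dotProduct_pencil_mulVec (d : Fin K → ℕ) (S : Fin K → Matrix n n ℝ) (x y : n → ℝ) :
    (fun i => Polynomial.C (x i)) ⬝ᵥ ((∑ l, ((X : ℝ[X]) ^ d l) • (S l).map Polynomial.C) *ᵥ fun i => Polynomial.C (y i)) =
      ∑ l, Polynomial.C (x ⬝ᵥ S l *ᵥ y) * (X : ℝ[X]) ^ d l := by
  have hC : ∀ l, Polynomial.C (x ⬝ᵥ S l *ᵥ y) =
      (fun i => Polynomial.C (x i)) ⬝ᵥ ((S l).map Polynomial.C *ᵥ fun i => Polynomial.C (y i)) := by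
    intro l
    rw [RingHom.map_dotProduct]
    congr 1
    funext i
    rw [Function.comp_apply, RingHom.map_mulVec]
    rfl
  simp_rw [hC, Matrix.sum_mulVec, Matrix.smul_mulVec, dotProduct_sum, dotProduct_smul, smul_eq_mul, mul_comm]

/-- … and that `K`-nomial is the determinant of the `1 × 1` pencil with letters `(xᵀ Sₗ y)` on the same support. [folklore] -/
theorem dotProduct_pencil_mulVec_eq_det (d : Fin K → ℕ) (S : Fin K → Matrix n n ℝ) (x y : n → ℝ) :
    (fun i => Polynomial.C (x i)) ⬝ᵥ ((∑ l, ((X : ℝ[X]) ^ d l) • (S l).map Polynomial.C) *ᵥ fun i => Polynomial.C (y i)) =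
      (∑ l, ((X : ℝ[X]) ^ d l) • (Matrix.of (fun _ _ => x ⬝ᵥ S l *ᵥ y) : Matrix (Fin 1) (Fin 1) ℝ).map Polynomial.C).det := by
  rw [dotProduct_pencil_mulVec, Matrix.det_fin_one]
  simp only [Matrix.sum_apply, Matrix.smul_apply, Matrix.map_apply, Matrix.of_apply, smul_eq_mul]
  exact Finset.sum_congr rfl fun l _ => mul_comm _ _

/-- **the bilinear compression obeys the size-1 law**: `Z₊(x̂ ⬝ᵥ G *ᵥ ŷ) ≤ B` whenever `PosRootLawOn 1 K B d`. [this work] -/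
theorem card_posRoots_dotProduct_pencil_mulVec_le {B : ℕ} {d : Fin K → ℕ} (hB : PosRootLawOn 1 K B d)
    (S : Fin K → Matrix n n ℝ) (x y : n → ℝ) :
    (((fun i => Polynomial.C (x i)) ⬝ᵥ ((∑ l, ((X : ℝ[X]) ^ d l) • (S l).map Polynomial.C) *ᵥ fun i => Polynomial.C (y i))
      ).roots.toFinset.filter (fun t => 0 < t)).card ≤ B := by
  rw [dotProduct_pencil_mulVec_eq_det]
  exact hB _ (fun l => by ext i j; fin_cases i; fin_cases j; rfl)

/-- Descartes at size 1: every `K`-nomial support obeys `PosRootLawOn 1 K (K − 1) d` (tree `stub_descartesCeiling`, `C(K,1) = K`).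
[folklore] -/
theorem posRootLawOn_one_descartes (hK : 0 < K) (d : Fin K → ℕ) : PosRootLawOn 1 K (K - 1) d := by
  intro S _
  have h := Summit.ValiantsHypothesis.ValiantsHypothesis.Theorems.LacunarySymmetroidMatrixDescartes.stub_descartesCeiling K 1 hK d S
  rw [show 1 + K - 1 = K by omega, Nat.choose_one_right] at h
  omega

/-! ## §2 The pair law -/

/-- evaluating the bilinear compression at a real point: `(x̂ ⬝ᵥ G *ᵥ ŷ)(t) = x ⬝ᵥ G(t) *ᵥ y`. [folklore] -/
theorem eval_dotProduct_pencil_mulVec (t : ℝ) (d : Fin K → ℕ) (S : Fin K → Matrix n n ℝ) (x y : n → ℝ) :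
    Polynomial.eval t ((fun i => Polynomial.C (x i)) ⬝ᵥ
        ((∑ l, ((X : ℝ[X]) ^ d l) • (S l).map Polynomial.C) *ᵥ fun i => Polynomial.C (y i))) =
      x ⬝ᵥ (∑ l, (t ^ d l) • S l) *ᵥ y := by
  simp only [dotProduct, Matrix.mulVec, Matrix.sum_apply, Matrix.smul_apply, Matrix.map_apply, smul_eq_mul,
    Polynomial.eval_finsetSum, Polynomial.eval_mul, Polynomial.eval_C, Polynomial.eval_pow, Polynomial.eval_X]

omit [Fintype n] in
/-- the evaluated pencil with symmetric letters is symmetric. [folklore] -/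
theorem isSymm_eval_pencil (t : ℝ) (d : Fin K → ℕ) (S : Fin K → Matrix n n ℝ) (hS : ∀ l, (S l).IsSymm) :
    (∑ l, (t ^ d l) • S l).IsSymm := by
  rw [Matrix.IsSymm, Matrix.transpose_sum]
  exact Finset.sum_congr rfl fun l _ => by rw [Matrix.transpose_smul, (hS l).eq]

/-- **kernel on the RIGHT kills the compression**: `G(t) y = 0 ⇒ (x̂ ⬝ᵥ G *ᵥ ŷ)(t) = 0` for every `x`. [folklore] -/
theorem eval_dotProduct_pencil_mulVec_eq_zero_of_kernel_right (t : ℝ) (d : Fin K → ℕ) (S : Fin K → Matrix n n ℝ) (x y : n → ℝ)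
    (hy : (∑ l, (t ^ d l) • S l) *ᵥ y = 0) :
    Polynomial.eval t ((fun i => Polynomial.C (x i)) ⬝ᵥ
        ((∑ l, ((X : ℝ[X]) ^ d l) • (S l).map Polynomial.C) *ᵥ fun i => Polynomial.C (y i))) = 0 := by
  rw [eval_dotProduct_pencil_mulVec, hy, dotProduct_zero]

/-- **kernel on the LEFT kills the compression** (symmetric letters): `G(t) x = 0 ⇒ (x̂ ⬝ᵥ G *ᵥ ŷ)(t) = 0` for every `y`. [folklore] -/
theorem eval_dotProduct_pencil_mulVec_eq_zero_of_kernel_left (t : ℝ) (d : Fin K → ℕ) (S : Fin K → Matrix n n ℝ)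
    (hS : ∀ l, (S l).IsSymm) (x y : n → ℝ) (hx : (∑ l, (t ^ d l) • S l) *ᵥ x = 0) :
    Polynomial.eval t ((fun i => Polynomial.C (x i)) ⬝ᵥ
        ((∑ l, ((X : ℝ[X]) ^ d l) • (S l).map Polynomial.C) *ᵥ fun i => Polynomial.C (y i))) = 0 := by
  rw [eval_dotProduct_pencil_mulVec, Matrix.dotProduct_mulVec, ← Matrix.mulVec_transpose, (isSymm_eval_pencil t d S hS).eq, hx,
    zero_dotProduct]

/-- **THE PAIR LAW.**  For a symmetric pencil `G = ∑ X^{dₗ} • Sₗ` and constant real vectors `x, y` whose bilinear compression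
`g_{x,y} = x̂ ⬝ᵥ G *ᵥ ŷ` is not the zero polynomial: every positive root of `det G` at which `x` OR `y` is a kernel vector of `G(t)` is a positive
root of the single `K`-nomial `g_{x,y}`; hence `|T_x ∪ T_y| ≤ Z₊(g_{x,y})` — two exact kernel-direction classes share ONE size-1 budget.
[this work] -/
theorem card_posRoots_union_le_of_kernel_pair [DecidableEq n] (d : Fin K → ℕ) (S : Fin K → Matrix n n ℝ) (hS : ∀ l, (S l).IsSymm) (x y : n → ℝ)
    (hg : ((fun i => Polynomial.C (x i)) ⬝ᵥ
      ((∑ l, ((X : ℝ[X]) ^ d l) • (S l).map Polynomial.C) *ᵥ fun i => Polynomial.C (y i))) ≠ 0) :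
    ((∑ l, ((X : ℝ[X]) ^ d l) • (S l).map Polynomial.C).det.roots.toFinset.filter
        (fun t => 0 < t ∧ ((∑ l, (t ^ d l) • S l) *ᵥ x = 0 ∨ (∑ l, (t ^ d l) • S l) *ᵥ y = 0))).card ≤
      (((fun i => Polynomial.C (x i)) ⬝ᵥ
        ((∑ l, ((X : ℝ[X]) ^ d l) • (S l).map Polynomial.C) *ᵥ fun i => Polynomial.C (y i))).roots.toFinset.filter
          (fun t => 0 < t)).card := by
  refine Finset.card_le_card fun t ht => ?_
  rw [Finset.mem_filter, Multiset.mem_toFinset] at ht ⊢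
  obtain ⟨-, hpos, hker⟩ := ht
  refine ⟨(Polynomial.mem_roots hg).mpr ?_, hpos⟩
  rcases hker with hx | hy
  · exact eval_dotProduct_pencil_mulVec_eq_zero_of_kernel_left t d S hS x y hx
  · exact eval_dotProduct_pencil_mulVec_eq_zero_of_kernel_right t d S x y hy

/-- **the pair law in class currency**: `|T_x ∪ T_y| ≤ B` under `PosRootLawOn 1 K B d` (so `≤ K − 1` by `posRootLawOn_one_descartes`).
[this work] -/
theorem card_posRoots_union_le_of_kernel_pair_class [DecidableEq n] {B : ℕ} {d : Fin K → ℕ} (hB : PosRootLawOn 1 K B d)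
    (S : Fin K → Matrix n n ℝ) (hS : ∀ l, (S l).IsSymm) (x y : n → ℝ)
    (hg : ((fun i => Polynomial.C (x i)) ⬝ᵥ
      ((∑ l, ((X : ℝ[X]) ^ d l) • (S l).map Polynomial.C) *ᵥ fun i => Polynomial.C (y i))) ≠ 0) :
    ((∑ l, ((X : ℝ[X]) ^ d l) • (S l).map Polynomial.C).det.roots.toFinset.filter
        (fun t => 0 < t ∧ ((∑ l, (t ^ d l) • S l) *ᵥ x = 0 ∨ (∑ l, (t ^ d l) • S l) *ᵥ y = 0))).card ≤ B :=
  (card_posRoots_union_le_of_kernel_pair d S hS x y hg).trans (card_posRoots_dotProduct_pencil_mulVec_le hB S x y)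

/-! ## §3 Counting corollary: `R` exact kernel directions capturing all positive roots force `2 · Z₊ ≤ R · B(1; d)` -/

/-- per-root count of ordered pairs: if `t` lies in the class of `a₀ ∈ fam`, then at least `2 (|fam| − 1)` ordered pairs `(a, b)` of distinct
members of `fam` have `t` in `T a ∪ T b`. [folklore] -/
theorem two_mul_card_sub_one_le_card_pairs {α : Type*} [DecidableEq α] (fam : Finset α) (T : α → Finset ℝ) (t : ℝ) {a₀ : α}
    (ha₀ : a₀ ∈ fam) (ht : t ∈ T a₀) :
    2 * (fam.card - 1) ≤ (fam.offDiag.filter fun p => t ∈ T p.1 ∪ T p.2).card := by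
  set E := fam.erase a₀ with hE
  have hEcard : E.card = fam.card - 1 := Finset.card_erase_of_mem ha₀
  have hf : Function.Injective (fun b : α => (a₀, b)) := fun b b' h => (Prod.mk.inj h).2
  have hg : Function.Injective (fun b : α => (b, a₀)) := fun b b' h => (Prod.mk.inj h).1
  have hsub : E.image (fun b => (a₀, b)) ∪ E.image (fun b => (b, a₀)) ⊆
      fam.offDiag.filter fun p => t ∈ T p.1 ∪ T p.2 := by
    intro p hp
    rw [Finset.mem_union, Finset.mem_image, Finset.mem_image] at hp
    rw [Finset.mem_filter, Finset.mem_offDiag]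
    rcases hp with ⟨b, hb, rfl⟩ | ⟨b, hb, rfl⟩
    · rw [hE, Finset.mem_erase] at hb
      exact ⟨⟨ha₀, hb.2, fun h => hb.1 h.symm⟩, Finset.mem_union_left _ ht⟩
    · rw [hE, Finset.mem_erase] at hb
      exact ⟨⟨hb.2, ha₀, hb.1⟩, Finset.mem_union_right _ ht⟩
  have hdisj : Disjoint (E.image fun b => (a₀, b)) (E.image fun b => (b, a₀)) := by
    rw [Finset.disjoint_left]
    intro p hp hp'
    rw [Finset.mem_image] at hp hp'
    obtain ⟨b, hb, rfl⟩ := hp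
    obtain ⟨b', hb', h⟩ := hp'
    rw [hE, Finset.mem_erase] at hb'
    exact hb'.1 (Prod.mk.inj h).1
  calc 2 * (fam.card - 1) = (E.image fun b => (a₀, b)).card + (E.image fun b => (b, a₀)).card := by
        rw [Finset.card_image_of_injective _ hf, Finset.card_image_of_injective _ hg, hEcard]; ring
    _ = (E.image (fun b => (a₀, b)) ∪ E.image (fun b => (b, a₀))).card := (Finset.card_union_of_disjoint hdisj).symm
    _ ≤ _ := Finset.card_le_card hsub

/-- **double counting**: if every `t ∈ P` lies in some class `T a` (`a ∈ fam`), all classes lie in `P`, and every pair of distinct classes has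
`|T a ∪ T b| ≤ B`, then `2 (|fam| − 1) · |P| ≤ |fam| (|fam| − 1) · B`. [folklore] -/
theorem two_mul_card_le_of_pair_bound {α : Type*} [DecidableEq α] (fam : Finset α) (T : α → Finset ℝ) (P : Finset ℝ) {B : ℕ}
    (hTP : ∀ a ∈ fam, T a ⊆ P) (hcover : ∀ t ∈ P, ∃ a ∈ fam, t ∈ T a)
    (hpair : ∀ a ∈ fam, ∀ b ∈ fam, a ≠ b → (T a ∪ T b).card ≤ B) :
    2 * (fam.card - 1) * P.card ≤ fam.card * (fam.card - 1) * B := by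
  have hcardU : ∀ p ∈ fam.offDiag, (T p.1 ∪ T p.2).card = ∑ t ∈ P, if t ∈ T p.1 ∪ T p.2 then 1 else 0 := by
    intro p hp
    rw [Finset.mem_offDiag] at hp
    have hsubP : T p.1 ∪ T p.2 ⊆ P := Finset.union_subset (hTP _ hp.1) (hTP _ hp.2.1)
    rw [← Finset.card_filter, Finset.filter_mem_eq_inter, Finset.inter_eq_right.mpr hsubP]
  have h1 : ∑ p ∈ fam.offDiag, (T p.1 ∪ T p.2).card ≤ fam.offDiag.card * B := by
    refine (Finset.sum_le_sum fun p hp => ?_).trans (by rw [Finset.sum_const, smul_eq_mul])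
    rw [Finset.mem_offDiag] at hp
    exact hpair _ hp.1 _ hp.2.1 hp.2.2
  have h2 : 2 * (fam.card - 1) * P.card ≤ ∑ p ∈ fam.offDiag, (T p.1 ∪ T p.2).card := by
    rw [Finset.sum_congr rfl hcardU, Finset.sum_comm]
    simp_rw [← Finset.card_filter]
    rw [mul_comm, Finset.card_eq_sum_ones P, Finset.sum_mul, one_mul]
    refine Finset.sum_le_sum fun t ht => ?_
    obtain ⟨a₀, ha₀, hta⟩ := hcover t ht
    exact two_mul_card_sub_one_le_card_pairs fam T t ha₀ hta
  rw [Finset.offDiag_card] at h1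
  have h3 : fam.card * fam.card - fam.card = fam.card * (fam.card - 1) := by
    rw [Nat.mul_sub_one]
  rw [h3] at h1
  exact h2.trans h1

/-- **COUNTING COROLLARY OF THE PAIR LAW — «sharp pencils must rotate».**  Let `G = ∑ X^{dₗ} • Sₗ` be a symmetric pencil and let `R ≥ 2`
constant real vectors `x a` (`a ∈ fam`) capture every positive root of `det G` as an EXACT kernel vector (`G(t) (x a) = 0` for some `a`), no two
of them letter-orthogonal (`x̂_a ⬝ᵥ G *ᵥ x̂_b ≢ 0` for `a ≠ b`).  Then `2 · Z₊(det G) ≤ R · B` whenever `PosRootLawOn 1 K B d` — half the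
single-direction bound `R · B` of `card_posRoots_pencil_le_card_mul_of_kernel_directions` (p665004) at `ι = ∅`; with Descartes (`B = K − 1`) a
pencil with `Z₊` positive roots needs `R ≥ 2 Z₊ / (K − 1)` exact kernel directions. [this work] -/
theorem two_mul_card_posRoots_le_card_mul [DecidableEq n] {B : ℕ} {d : Fin K → ℕ} (hB : PosRootLawOn 1 K B d)
    (S : Fin K → Matrix n n ℝ) (hS : ∀ l, (S l).IsSymm) {α : Type*} [DecidableEq α] (fam : Finset α) (x : α → n → ℝ)
    (hR : 2 ≤ fam.card)
    (hcover : ∀ t : ℝ, 0 < t → (∑ l, ((X : ℝ[X]) ^ d l) • (S l).map Polynomial.C).det.IsRoot t →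
      ∃ a ∈ fam, (∑ l, (t ^ d l) • S l) *ᵥ x a = 0)
    (hpair : ∀ a ∈ fam, ∀ b ∈ fam, a ≠ b → ((fun i => Polynomial.C (x a i)) ⬝ᵥ
      ((∑ l, ((X : ℝ[X]) ^ d l) • (S l).map Polynomial.C) *ᵥ fun i => Polynomial.C (x b i))) ≠ 0) :
    2 * ((∑ l, ((X : ℝ[X]) ^ d l) • (S l).map Polynomial.C).det.roots.toFinset.filter (fun t => 0 < t)).card ≤ fam.card * B := by
  set G := (∑ l, ((X : ℝ[X]) ^ d l) • (S l).map Polynomial.C) with hG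
  set P := G.det.roots.toFinset.filter (fun t => 0 < t) with hP
  set T : α → Finset ℝ := fun a => P.filter fun t => (∑ l, (t ^ d l) • S l) *ᵥ x a = 0 with hT
  have hTP : ∀ a ∈ fam, T a ⊆ P := fun a _ => Finset.filter_subset _ _
  have hcov : ∀ t ∈ P, ∃ a ∈ fam, t ∈ T a := by
    intro t ht
    have ht' := ht
    rw [hP, Finset.mem_filter, Multiset.mem_toFinset] at ht'
    obtain ⟨hroot, hpos⟩ := ht'
    have hGdet : G.det ≠ 0 := (Polynomial.mem_roots'.mp hroot).1
    obtain ⟨a, ha, hker⟩ := hcover t hpos ((Polynomial.mem_roots hGdet).mp hroot)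
    exact ⟨a, ha, Finset.mem_filter.mpr ⟨ht, hker⟩⟩
  have hpairB : ∀ a ∈ fam, ∀ b ∈ fam, a ≠ b → (T a ∪ T b).card ≤ B := by
    intro a ha b hb hab
    have hU : T a ∪ T b = G.det.roots.toFinset.filter
        (fun t => 0 < t ∧ ((∑ l, (t ^ d l) • S l) *ᵥ x a = 0 ∨ (∑ l, (t ^ d l) • S l) *ᵥ x b = 0)) := by
      rw [hT, hP, ← Finset.filter_or, Finset.filter_filter]
    rw [hU]
    exact card_posRoots_union_le_of_kernel_pair_class hB S hS (x a) (x b) (hpair a ha b hb hab)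
  have key := two_mul_card_le_of_pair_bound fam T P hTP hcov hpairB
  have hR1 : 0 < fam.card - 1 := by omega
  have key' : (fam.card - 1) * (2 * P.card) ≤ (fam.card - 1) * (fam.card * B) := by
    calc (fam.card - 1) * (2 * P.card) = 2 * (fam.card - 1) * P.card := by ring
      _ ≤ fam.card * (fam.card - 1) * B := key
      _ = (fam.card - 1) * (fam.card * B) := by ring
  exact Nat.le_of_mul_le_mul_left key' hR1

/-- **Descartes form**: with `B = K − 1` (`posRootLawOn_one_descartes`), `2 · Z₊(det G) ≤ R · (K − 1)`. [this work] -/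
theorem two_mul_card_posRoots_le_card_mul_descartes [DecidableEq n] {d : Fin K → ℕ} (hK : 0 < K)
    (S : Fin K → Matrix n n ℝ) (hS : ∀ l, (S l).IsSymm) {α : Type*} [DecidableEq α] (fam : Finset α) (x : α → n → ℝ)
    (hR : 2 ≤ fam.card)
    (hcover : ∀ t : ℝ, 0 < t → (∑ l, ((X : ℝ[X]) ^ d l) • (S l).map Polynomial.C).det.IsRoot t →
      ∃ a ∈ fam, (∑ l, (t ^ d l) • S l) *ᵥ x a = 0)
    (hpair : ∀ a ∈ fam, ∀ b ∈ fam, a ≠ b → ((fun i => Polynomial.C (x a i)) ⬝ᵥ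
      ((∑ l, ((X : ℝ[X]) ^ d l) • (S l).map Polynomial.C) *ᵥ fun i => Polynomial.C (x b i))) ≠ 0) :
    2 * ((∑ l, ((X : ℝ[X]) ^ d l) • (S l).map Polynomial.C).det.roots.toFinset.filter (fun t => 0 < t)).card ≤
      fam.card * (K - 1) :=
  two_mul_card_posRoots_le_card_mul (posRootLawOn_one_descartes hK d) S hS fam x hR hcover hpair

end Summit.ValiantsHypothesis.ValiantsHypothesis.Theorems.KPlusLogSqLaw.TowerGraft
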